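import Mathlib.Combinatorics.SimpleGraph.Clique
import Mathlib.Combinatorics.SimpleGraph.Finite
import Mathlib.Probability.ProbabilityMassFunction.Constructions
import Mathlib.Probability.Distributions.Uniform
import Mathlib.Topology.Instances.ENNReal.Lemmas
import Literature.Computability.Complexity.Randomized
import HarnessLib

/-!
# The planted clique problem: `G(n, 1/2)` with a planted `k`-clique

Definition request `wi-03901` (route PneNP/PlantedClique). Graphs on `Fin n` are edge-indicator
vectors `x : (⊤ : SimpleGraph (Fin n)).edgeSet → Bool` — the input type of `Literature.Computability.Complexity.cliqueFn`, so
that CLIQUE facts (Razborov, Alon–Boppana) and planted-clique facts share one encoding.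

* `EdgeVec n`, `graphOfEdgeVec x` (the simple graph with edge set `{e | x e}`);
* `erdosRenyiHalf n : PMF (EdgeVec n)` — `G(n, 1/2)`, the uniform distribution on edge vectors;
* `kSubsets n k`, `plant S x` (force all edges inside `S`), `plantedCliqueJoint n k : PMF (Finset
  (Fin n) × EdgeVec n)` — `S` uniform among `k`-subsets, `x ∼ G(n,1/2)`, output `(S, plant S x)`
  (Jerrum 1992, §1; Kučera 1995, §1; Barak et al. 2016/2019, §1, "`G(n,1/2,ω)`"), and its graph
  marginal `plantedCliqueDist n k`;
* the algorithmic tasks in G01's randomised-algorithm framework (`Literature.Computability.Complexity.RandAlg`;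
  "probabilistic polynomial time" is `RandAlg.IsPolyTime id eb`, i.e. the `IsPPT` of one-way-function
  adversaries written out — see the cone note below): `encodeEdgeVec` (upper-triangular adjacency
  bits), `decodeVertexSet`, `recoverProb A k n` (probability that `A(1ⁿ, G)` outputs the planted
  set), `acceptProbOn`, `typeIError`, `typeIIError`;
* hardness predicates `PlantedCliqueRecoveryHard k` (every PPT `A` recovers with probability
  `→ 0`) and `PlantedCliqueDetectionHard k` (no PPT test has type-I + type-II error `→ 0`)
  [Jerrum 1992, §5 (conjectured hardness for `k = n^{1/2-ε}`); Barak et al. 2019, §1 (search and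
  decision variants)];
* `IsUniqueMaxClique`, `uniqueMaxCliqueProb n k` and the statement shape `PlantedCliqueUniqueWhp k`
  ("the planted `k(n)`-clique is the unique maximum clique w.h.p.", the target of the route's
  uniqueness lemma for `k n ≥ 3 log₂ n`; NOT asserted here).

Design notes. `kSubsets n k` uses `min k n` so that it is always nonempty (for `k > n` the
"planted set" is all of `Fin n`; documented junk). Algorithms receive `boolPair 1ⁿ (encodeEdgeVec x)`
and, for recovery, answer with `n` indicator bits (`decodeVertexSet`). Nothing is asserted: the two
hardness predicates are conjectures/hypotheses of the route.

Cone note (item `defn-BernoulliVecStandalone`). This file imports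
`Literature.Computability.Complexity.Randomized` (the home of `RandAlg` / `RandAlg.IsPolyTime`) and NOT
`Literature.Computability.Cryptography.OneWayFunctions`: the latter was imported only for the
readability abbreviation `IsPPT A eb := A.IsPolyTime id eb`, and it dragged the four open
conjectures `OWFExist`, `WeakOWFExist`, `NonuniformOWFExist`, `IOOWFExist` into the module import
cone of every planted-clique and `G(n, p)` file (`PlantedCliqueLowDegree`, `ErdosRenyi`,
`RandomRamsey(Proofs)`, route PneNP/RamseyThreshold) although no declaration there uses them. The
two hardness predicates below therefore spell `A.IsPolyTime id id` / `T.IsPolyTime id (fun b => [b])`,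
which is `IsPPT A id` / `IsPPT T (fun b => [b])` unfolded (reducibly definitionally equal; users
holding `h : IsPPT A id` apply it unchanged).

## References

* M. Jerrum, *Large cliques elude the Metropolis process*, Random Structures Algorithms 3 (1992)
  347–359 [Jerrum1992].
* L. Kučera, *Expected complexity of graph partitioning problems*, Discrete Appl. Math. 57 (1995)
  193–212 [Kucera1995].
* B. Barak, S. Hopkins, J. Kelner, P. Kothari, A. Moitra, A. Potechin, *A nearly tight
  sum-of-squares lower bound for the planted clique problem*, FOCS 2016 / SIAM J. Comput. 48
  (2019); arXiv:1604.03084, §1 and Remark 2 [BarakHopkinsKelnerKothariMoitraPotechin2019].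
-/

noncomputable section

namespace Literature.Probability.RandomGraphs.PlantedClique

open Literature.Computability.Complexity _root_.Computability Filter Topology Finset

/-! ### Graphs as edge vectors, `G(n,1/2)` and the planted distribution -/

/-- Edge-indicator vectors of graphs on `Fin n` (the input type of `Literature.Computability.Complexity.cliqueFn`).
[Jerrum 1992, §1] [folklore] -/
abbrev EdgeVec (n : ℕ) : Type := (⊤ : SimpleGraph (Fin n)).edgeSet → Bool

/-- The simple graph encoded by an edge vector. [folklore] -/
def graphOfEdgeVec {n : ℕ} (x : EdgeVec n) : SimpleGraph (Fin n) :=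
  SimpleGraph.fromEdgeSet {e | ∃ h : e ∈ (⊤ : SimpleGraph (Fin n)).edgeSet, x ⟨e, h⟩ = true}

/-- Adjacency in `graphOfEdgeVec x`: distinct vertices whose edge indicator is `true`. [folklore] -/
theorem graphOfEdgeVec_adj {n : ℕ} (x : EdgeVec n) (u v : Fin n) :
    (graphOfEdgeVec x).Adj u v ↔ ∃ h : u ≠ v, x ⟨s(u, v), by simpa using h⟩ = true := by
  simp only [graphOfEdgeVec, SimpleGraph.fromEdgeSet_adj, Set.mem_setOf_eq, ne_eq]
  constructor
  · rintro ⟨⟨h, hx⟩, hne⟩; exact ⟨hne, hx⟩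
  · rintro ⟨hne, hx⟩; exact ⟨⟨by simpa using hne, hx⟩, hne⟩

/-- **`G(n, 1/2)`**: the uniform distribution on edge vectors (each of the `n choose 2` edges
present independently with probability `1/2`). [Jerrum 1992, §1; Kučera 1995, §1] [folklore] -/
def erdosRenyiHalf (n : ℕ) : PMF (EdgeVec n) := PMF.uniformOfFintype (EdgeVec n)

/-- The candidate planted sets: all `min k n`-element subsets of `Fin n` (`= k`-subsets when
`k ≤ n`; for `k > n` the single set `univ`, a documented junk case). [folklore] -/
def kSubsets (n k : ℕ) : Finset (Finset (Fin n)) := powersetCard (min k n) univ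

/-- `kSubsets n k` is nonempty. [folklore] -/
theorem kSubsets_nonempty (n k : ℕ) : (kSubsets n k).Nonempty := by
  rw [kSubsets, powersetCard_nonempty, card_univ, Fintype.card_fin]
  exact min_le_right k n

/-- Members of `kSubsets n k` have `min k n` elements. [folklore] -/
theorem card_of_mem_kSubsets {n k : ℕ} {S : Finset (Fin n)} (h : S ∈ kSubsets n k) :
    S.card = min k n := (mem_powersetCard.1 h).2

open Classical in
/-- Planting a clique on `S`: every edge with both endpoints in `S` is switched on, all other edge
indicators are kept. [Jerrum 1992, §1; Kučera 1995, §1] [folklore] -/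
def plant {n : ℕ} (S : Finset (Fin n)) (x : EdgeVec n) : EdgeVec n :=
  fun e => x e || decide (∀ v ∈ (e : Sym2 (Fin n)), v ∈ S)

/-- After planting, `S` is a clique. [folklore] -/
theorem isClique_plant {n : ℕ} (S : Finset (Fin n)) (x : EdgeVec n) :
    (graphOfEdgeVec (plant S x)).IsClique (S : Set (Fin n)) := by
  classical
  intro u hu v hv huv
  rw [graphOfEdgeVec_adj]
  refine ⟨huv, ?_⟩
  simp only [plant, Bool.or_eq_true, decide_eq_true_eq]
  exact Or.inr fun w hw => by
    rcases Sym2.mem_iff.1 hw with rfl | rfl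
    · exact hu
    · exact hv

/-- Planting only adds edges. [folklore] -/
theorem le_plant {n : ℕ} (S : Finset (Fin n)) (x : EdgeVec n) (e) : x e ≤ plant S x e := by
  simp only [plant]
  exact Bool.left_le_or _ _

/-- **The planted-clique distribution `G(n, 1/2, k)`, joint form**: draw `S` uniformly among the
`k`-subsets of `Fin n` and `x ∼ G(n,1/2)` independently, output `(S, plant S x)`.
[Jerrum 1992, §1; Kučera 1995, §1; Barak et al. 2019, §1 (`G(n,1/2,ω)`)]
[cite: Jerrum1992, §1] -/
def plantedCliqueJoint (n k : ℕ) : PMF (Finset (Fin n) × EdgeVec n) :=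
  (PMF.uniformOfFinset (kSubsets n k) (kSubsets_nonempty n k)).bind fun S =>
    (erdosRenyiHalf n).map fun x => (S, plant S x)

/-- The planted-clique GRAPH distribution (marginal of `plantedCliqueJoint`).
[Jerrum 1992, §1; Kučera 1995, §1] [cite: Jerrum1992, §1] -/
def plantedCliqueDist (n k : ℕ) : PMF (EdgeVec n) := (plantedCliqueJoint n k).map Prod.snd

/-- In the support of the joint law the first component is a planted set of the right size and is
a clique of the graph. [folklore] -/
theorem mem_support_plantedCliqueJoint {n k : ℕ} {p : Finset (Fin n) × EdgeVec n}
    (h : p ∈ (plantedCliqueJoint n k).support) :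
    p.1.card = min k n ∧ (graphOfEdgeVec p.2).IsClique (p.1 : Set (Fin n)) := by
  simp only [plantedCliqueJoint, PMF.support_bind, Set.mem_iUnion, PMF.support_map,
    Set.mem_image, exists_prop] at h
  obtain ⟨S, hS, x, -, rfl⟩ := h
  rw [PMF.mem_support_uniformOfFinset_iff] at hS
  exact ⟨card_of_mem_kSubsets hS, isClique_plant S x⟩

/-! ### Algorithms: encodings, recovery and detection probabilities -/

/-- Upper-triangular adjacency encoding of an edge vector: the bits `x {i, j}` for `i < j` in
lexicographic order (`n choose 2` bits). [Kučera 1995, §1 (input model)] [folklore] -/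
def encodeEdgeVec {n : ℕ} (x : EdgeVec n) : List Bool :=
  (List.finRange n).flatMap fun i => (List.finRange n).filterMap fun j =>
    if h : i < j then some (x ⟨s(i, j), by simp [h.ne]⟩) else none

/-- Decoding an output string to a vertex set: vertex `i` is selected iff bit `i` is `true`.
[folklore] -/
def decodeVertexSet (n : ℕ) (w : List Bool) : Finset (Fin n) := univ.filter fun i => w.getD i false

/-- The recovery probability of a randomised algorithm `A` at size `n` with clique size `k n`:
`Pr_{(S,G) ∼ G(n,1/2,k n), coins}[A(1ⁿ, G) = S]` (input `boolPair 1ⁿ (encodeEdgeVec G)`, output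
decoded by `decodeVertexSet`). [Jerrum 1992, §1; Barak et al. 2019, §1 (search variant)]
[cite: Jerrum1992, §1] -/
def recoverProb (A : RandAlg (List Bool) (List Bool)) (k : ℕ → ℕ) (n : ℕ) : ℝ :=
  (((plantedCliqueJoint n (k n)).bind fun p =>
      (A.outputPMF id (boolPair (unaryEncodeNat n) (encodeEdgeVec p.2))).map fun w =>
        decide (decodeVertexSet n w = p.1)).toOuterMeasure {true}).toReal

/-- Acceptance probability of a randomised test `T` on `G ∼ D` (input `boolPair 1ⁿ (encodeEdgeVec G)`).
[Barak et al. 2019, §1 (decision variant)] [folklore] -/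
def acceptProbOn {n : ℕ} (T : RandAlg (List Bool) Bool) (D : PMF (EdgeVec n)) : ℝ :=
  ((D.bind fun G => T.outputPMF id (boolPair (unaryEncodeNat n) (encodeEdgeVec G))).toOuterMeasure
    {true}).toReal

/-- Type-I error of `T` at size `n`: accepting ("planted") on `G(n,1/2)`. [folklore] -/
def typeIError (T : RandAlg (List Bool) Bool) (n : ℕ) : ℝ := acceptProbOn T (erdosRenyiHalf n)

/-- Type-II error of `T`: rejecting on the planted distribution `G(n,1/2,k n)`. [folklore] -/
def typeIIError (T : RandAlg (List Bool) Bool) (k : ℕ → ℕ) (n : ℕ) : ℝ :=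
  1 - acceptProbOn T (plantedCliqueDist n (k n))

/-! ### Hardness predicates (hypotheses of the route; nothing is asserted) -/

/-- **Planted-clique RECOVERY is hard at clique size `k`**: every probabilistic polynomial-time
algorithm (`A.IsPolyTime id id`, i.e. `IsPPT A id` written out) recovers the planted set with
probability tending to `0`.
[Jerrum 1992, §5 (conjecture for `k = n^{1/2-ε}`); Barak et al. 2019, §1 (search variant)]
[cite: Jerrum1992, §5] -/
def PlantedCliqueRecoveryHard (k : ℕ → ℕ) : Prop :=
  ∀ A : RandAlg (List Bool) (List Bool), A.IsPolyTime id id →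
    Tendsto (recoverProb A k) atTop (𝓝 0)

/-- **Planted-clique DETECTION is hard at clique size `k`**: no probabilistic polynomial-time test
(`T.IsPolyTime id (fun b => [b])`, i.e. `IsPPT T (fun b => [b])` written out) distinguishes
`G(n,1/2,k n)` from `G(n,1/2)` with vanishing error, i.e. for no PPT `T` does type-I + type-II
error tend to `0`. [Barak et al. 2019, §1, Remark 2 (decision variant);
Jerrum 1992, §5] [cite: BarakHopkinsKelnerKothariMoitraPotechin2019, §1 Remark 2] -/
def PlantedCliqueDetectionHard (k : ℕ → ℕ) : Prop :=
  ∀ T : RandAlg (List Bool) Bool, T.IsPolyTime id (fun b => [b]) →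
    ¬ Tendsto (fun n => typeIError T n + typeIIError T k n) atTop (𝓝 0)

/-! ### Uniqueness of the planted clique -/

/-- `S` is the unique maximum clique of `G`: a clique, and every clique with at least `|S|`
vertices is `S`. [Jerrum 1992, §1] [folklore] -/
def IsUniqueMaxClique {n : ℕ} (G : SimpleGraph (Fin n)) (S : Finset (Fin n)) : Prop :=
  G.IsClique (S : Set (Fin n)) ∧ ∀ T : Finset (Fin n), G.IsClique (T : Set (Fin n)) →
    S.card ≤ T.card → T = S

/-- The probability, under `G(n,1/2,k)`, that the planted set is the unique maximum clique.
[Jerrum 1992, §1; Kučera 1995, §1] [folklore] -/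
def uniqueMaxCliqueProb (n k : ℕ) : ENNReal :=
  (plantedCliqueJoint n k).toOuterMeasure {p | IsUniqueMaxClique (graphOfEdgeVec p.2) p.1}

/-- Statement shape of the route's uniqueness lemma: at clique size `k(n)` (intended
`k n ≥ 3 log₂ n`), the planted set is the unique maximum clique with probability `→ 1`. NOT
asserted here. [Jerrum 1992, §1 (`ω(G) ~ 2 log₂ n` for `G(n,1/2)`); Kučera 1995, §1] [folklore] -/
def PlantedCliqueUniqueWhp (k : ℕ → ℕ) : Prop :=
  Tendsto (fun n => uniqueMaxCliqueProb n (k n)) atTop (𝓝 1)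

/-! ### Elementary API -/

/-- Recovery probabilities lie in `[0, 1]`. [folklore] -/
theorem recoverProb_mem_Icc (A : RandAlg (List Bool) (List Bool)) (k : ℕ → ℕ) (n : ℕ) :
    recoverProb A k n ∈ Set.Icc (0 : ℝ) 1 := by
  refine ⟨ENNReal.toReal_nonneg, ENNReal.toReal_le_of_le_ofReal zero_le_one ?_⟩
  rw [ENNReal.ofReal_one]
  refine (MeasureTheory.OuterMeasure.mono _ (Set.subset_univ _)).trans_eq ?_
  exact (PMF.toOuterMeasure_apply_eq_one_iff _ _).2 (Set.subset_univ _)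

/-- Recovery hardness is monotone under pointwise domination of recovery probabilities (e.g. an
algorithm that post-processes another cannot do better than the bound it inherits). [folklore] -/
theorem tendsto_zero_of_le {f g : ℕ → ℝ} (hg : Tendsto g atTop (𝓝 0)) (h0 : ∀ n, 0 ≤ f n)
    (hle : ∀ n, f n ≤ g n) : Tendsto f atTop (𝓝 0) :=
  squeeze_zero h0 hle hg

end Literature.Probability.RandomGraphs.PlantedClique

end
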